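import Summits.BirchSwinnertonDyer.BirchSwinnertonDyer.Theorems.EisensteinPrimesMazurMCOnCellBTwistbackUnitEndP5Cell3270h1
import Summits.BirchSwinnertonDyer.BirchSwinnertonDyer.Theorems.EisensteinPrimesMazurMCOnCellBTwistbackUnitEndP5Cell4910g1
import Summits.BirchSwinnertonDyer.BirchSwinnertonDyer.Theorems.EisensteinPrimesMazurMCOnCellBTwistbackUnitEndP5Cell16530ba1
import Summits.BirchSwinnertonDyer.BirchSwinnertonDyer.Theorems.EisensteinPrimesMazurMCOnCellBTwistbackUnitEndP5Cell28965i1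
import Summits.BirchSwinnertonDyer.BirchSwinnertonDyer.Theorems.EisensteinPrimesMazurMCOnCellBTwistbackUnitEndP7Cell546f1Base
import Summits.BirchSwinnertonDyer.BirchSwinnertonDyer.Theorems.EisensteinPrimesMazurMCOnCellBOfNamedFactsV9
import Summits.BirchSwinnertonDyer.BirchSwinnertonDyer.Theorems.EisensteinPrimesMazurMCOnCellBTwistbackDefectSwapUp
import HarnessLib

/-!
# Crux 3 `MazurMCOnCellB` (stmt-BirchSwinnertonDyer-19033), line `twistback` v12 — DISTANCE-0 DISPLAYS at `p = 5` and `p = 7`: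
# the X2b classes displayed by this seat at `p ≠ 3` are THEMSELVES Ш-unit vertices, so Mazur's main conjecture and `BSD(E,p)`
# at their base members follow from PUBLISHED inputs only (`PublishedInputs` + Wuthrich 2014 Prop. 21) and TWO Cremona readings

Width seat bsd-line-x2-p1-w5 (g5), cell `bsd-eis` (run/shared/lean/pub/bsd-eis/), 2026-08-29; `--supports stmt-BirchSwinnertonDyer-19033
--as helper`. THEOREMS ONLY (no `def`, no named fact, no `sorry`, no instance). WHY (lam-a g18 04:43:32Z, kit CHK column; this
seat's BSD self-checks): unlike the `p = 3` atlas A10 — where `#Ш_an = 9` at EVERY member of all 127 classes, so a Ш-unit vertex is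
two admissible twists away — every screened X2b class at `p = 5` (225/225) and `p = 7` (10/10) has a member with `v_p(#Ш_an) = 0`
(Cremona). For such a class the registered stub 6⁷'s LEFT disjunct holds at distance 0 (`Relation.ReflTransGen.refl`, no field, no
twist), and the tree's PUBLISHED-inputs-only doors apply: LEAD g14's `…OfNamedFactsV9.mazurMainConjectureAt_of_namedFacts_of_classShaUnit`
(Wuthrich Prop. 21 + GZK ⇒ `BSDp`, Cassels, `X2.mazurMainConjectureAt_of_bsdp_of_red`) and w3 g14's
`…DefectSwapUp.bsdp_of_cellB_of_classShaUnit`. So the two-step files of this seat (p691901 … p697238, and the `p = 7` pair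
p694064/p695701) ILLUSTRATE the distance-2 machinery at `p ≠ 3`; the per-pair STATUS of these cells is better than that: this file
records it — cone = {`PublishedInputs` (item 19037, PUB), Wuthrich 2014 Prop. 21 (PUB)}, readings = `hr` (`r_an = 0`) and `hunit`
(`#Ш_an` of the base member a `p`-adic unit; Cremona `allbsd`: `#Ш_an = 1` for every curve below). The kernel input per cell is the
`X2.CellB` theorem of the cited display file (split multiplicative at `p`, rational point of order `p`, `E[p]` reducible, `¬ GVPar`).

PER CELL (ns `…<cell file>`): `cellB_<E>_of_analyticRank` from
* `3270h1 = [1, 0, 0, 340, -528]` at `p = 5` — `…ackUnitEndP5Cell3270h1` (p696171); Cremona: `#T = 5`, `∏c = 125`, `Ω = 0.83467610`, `L(E,1) = 4.17338051`, `#Ш_an = 1`;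
* `4910g1 = [1, 1, 1, 4165, 27465]` at `p = 5` — `…ackUnitEndP5Cell4910g1` (p696533); Cremona: `#T = 5`, `∏c = 100`, `Ω = 0.47448577`, `L(E,1) = 1.89794307`, `#Ш_an = 1`;
* `16530ba1 = [1, 0, 0, -2975, 62457]` at `p = 5` — `…kUnitEndP5Cell16530ba1` (p697205); Cremona: `#T = 5`, `∏c = 125`, `Ω = 1.26443525`, `L(E,1) = 6.32217624`, `#Ш_an = 1`;
* `28965i1 = [0, 1, 1, 7560, 1587944]` at `p = 5` — `…ckUnitEndP5Cell28965i1` (p697238); Cremona: `#T = 5`, `∏c = 100`, `Ω = 0.36679870`, `L(E,1) = 1.46719481`, `#Ш_an = 1`;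
* `546f1 = [1, 0, 0, 714, -82908]` at `p = 7` — `…UnitEndP7Cell546f1Base` (p694064); Cremona: `#T = 7`, `∏c = 343`, `Ω = 0.38165254`, `L(E,1) = 2.67156776`, `#Ш_an = 1`;
HONEST FRAMING: conditional per-pair theorems; readings are NOT theorems (`analyticRank = 0` and `#Ш_an` unit are Cremona's numerics);
nothing is booked; Mazur's main conjecture / BSD is proved for NO curve unconditionally; no summit statement is proved; closes no
registered stub (6⁷ is the class-wide supply statement); 0 cells / labels / stubs / tiers move. References: [Wuthrich2014] Prop. 21,
Thm. 16; [SteinWuthrich2013] Thm. 6.1; [GreenbergLNM1716] §4–5; [MilneADT2006] I.7.3; [Miller2011LMS] Def. 1.1; Cremona allbsd.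
-/
set_option autoImplicit false
-- `Summit.BirchSwinnertonDyer.BirchSwinnertonDyer.…`: the summit and its single sub-problem share a name.
set_option linter.dupNamespace false
noncomputable section
open scoped Classical
open WeierstrassCurve NumberField Literature.NumberTheory.EllipticCurves Literature.NumberTheory.EllipticCurves.ModularForms
  Literature.NumberTheory.EllipticCurves.Rank1Residual Literature.NumberTheory.EllipticCurves.Rank1Residual.Typed
  Literature.NumberTheory.EllipticCurves.Wuthrich2014 Literature.NumberTheory.GaloisCohomology
  Summit.BirchSwinnertonDyer.Rank1Residual Summit.BirchSwinnertonDyer.Rank1Residual.X2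
  Summit.BirchSwinnertonDyer.BirchSwinnertonDyer.Theses Summit.BirchSwinnertonDyer.BirchSwinnertonDyer.Theorems
  Summit.BirchSwinnertonDyer.BirchSwinnertonDyer.Theorems.EisensteinPrimesMazurMCOnCellBTwistbackTwoStepDefs

namespace Summit.BirchSwinnertonDyer.BirchSwinnertonDyer.Theorems.EisensteinPrimesMazurMCOnCellBTwistbackShaUnitVertexDisplays02

/-! ## `(3270h1, 5)` — a Ш-unit vertex (`#Ш_an(3270h1) = 1`) -/

-- 6⁷'s LEFT disjunct at `(3270h1, 5)` at distance 0: the statement does not depend on the curve — it IS the landed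
-- `…ShaUnitVertexDisplays01.connectedClassShaUnit_395c1_refl` (p698143), applied to this `W` and `hunit`; not restated (dedup).

/-- **Mazur's main conjecture at `(3270h1, 5)` from PUBLISHED inputs only + two Cremona readings** (`hr`: `r_an = 0`, `L(E,1) = 4.17338051`;
`hunit`: `#Ш_an = 1`, `#T = 5`, `∏c = 125`, `Ω = 0.83467610`): `X2.CellB` in the kernel (p696171's `cellB_3270h1_of_analyticRank`), the class's
own unit member (identity isogeny), `…OfNamedFactsV9.mazurMainConjectureAt_of_namedFacts_of_classShaUnit` (Wuthrich Prop. 21 + GZK,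
Cassels, `X2.mazurMainConjectureAt_of_bsdp_of_red`). Cone: `PublishedInputs`, `sha_dvd_analyticSha` — both PUBLISHED. CONDITIONAL;
nothing booked. [cite: Wuthrich2014, Prop. 21 (p. 400) and Thm. 16 (p. 397)] [cite: MilneADT2006, Thm. I.7.3] [cite: Miller2011LMS, Def. 1.1] -/
theorem mazurMainConjectureAt_3270h1_at_five_of_shaUnit (hP : EisensteinPrimes.PublishedInputs) (hW21 : sha_dvd_analyticSha)
    (W : WeierstrassCurve ℚ) [W.IsElliptic] [W.IsGloballyMinimal] (hW : W = ⟨1, 0, 0, 340, -528⟩) (hr : W.analyticRank = 0)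
    (hunit : ∃ q : ℚ, shaAn W = (q : ℂ) ∧ padicValRat 5 q = 0) : X2.MazurMainConjectureAt W 5 := by
  subst hW
  exact EisensteinPrimesMazurMCOnCellBOfNamedFactsV9.mazurMainConjectureAt_of_namedFacts_of_classShaUnit hP hW21 _ 5
    (EisensteinPrimesMazurMCOnCellBTwistbackUnitEndP5Cell3270h1.cellB_3270h1_of_analyticRank hr)
    ⟨_, inferInstance, inferInstance, WeierstrassCurve.isIsogenous_self _, hunit⟩

/-- **`BSD(E, 5)` at `3270h1` from PUBLISHED inputs only + the same two readings** (w3 g14's `…DefectSwapUp.bsdp_of_cellB_of_classShaUnit`: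
Wuthrich Prop. 21 + GZK at the unit member, Cassels). CONDITIONAL; nothing booked.
[cite: Wuthrich2014, Prop. 21 (p. 400)] [cite: MilneADT2006, Thm. I.7.3] [cite: Miller2011LMS, Def. 1.1] -/
theorem bsdp_3270h1_at_five_of_shaUnit (hP : EisensteinPrimes.PublishedInputs) (hW21 : sha_dvd_analyticSha)
    (W : WeierstrassCurve ℚ) [W.IsElliptic] [W.IsGloballyMinimal] (hW : W = ⟨1, 0, 0, 340, -528⟩) (hr : W.analyticRank = 0)
    (hunit : ∃ q : ℚ, shaAn W = (q : ℂ) ∧ padicValRat 5 q = 0) : BSDp W 5 := by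
  subst hW
  exact EisensteinPrimesMazurMCOnCellBTwistbackDefectSwapUp.bsdp_of_cellB_of_classShaUnit hP hW21 _ 5
    (EisensteinPrimesMazurMCOnCellBTwistbackUnitEndP5Cell3270h1.cellB_3270h1_of_analyticRank hr) ⟨_, inferInstance, inferInstance, WeierstrassCurve.isIsogenous_self _, hunit⟩

/-! ## `(4910g1, 5)` — a Ш-unit vertex (`#Ш_an(4910g1) = 1`) -/

-- 6⁷'s LEFT disjunct at `(4910g1, 5)` at distance 0: the statement does not depend on the curve — it IS the landed
-- `…ShaUnitVertexDisplays01.connectedClassShaUnit_395c1_refl` (p698143), applied to this `W` and `hunit`; not restated (dedup).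

/-- **Mazur's main conjecture at `(4910g1, 5)` from PUBLISHED inputs only + two Cremona readings** (`hr`: `r_an = 0`, `L(E,1) = 1.89794307`;
`hunit`: `#Ш_an = 1`, `#T = 5`, `∏c = 100`, `Ω = 0.47448577`): `X2.CellB` in the kernel (p696533's `cellB_4910g1_of_analyticRank`), the class's
own unit member (identity isogeny), `…OfNamedFactsV9.mazurMainConjectureAt_of_namedFacts_of_classShaUnit` (Wuthrich Prop. 21 + GZK,
Cassels, `X2.mazurMainConjectureAt_of_bsdp_of_red`). Cone: `PublishedInputs`, `sha_dvd_analyticSha` — both PUBLISHED. CONDITIONAL;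
nothing booked. [cite: Wuthrich2014, Prop. 21 (p. 400) and Thm. 16 (p. 397)] [cite: MilneADT2006, Thm. I.7.3] [cite: Miller2011LMS, Def. 1.1] -/
theorem mazurMainConjectureAt_4910g1_at_five_of_shaUnit (hP : EisensteinPrimes.PublishedInputs) (hW21 : sha_dvd_analyticSha)
    (W : WeierstrassCurve ℚ) [W.IsElliptic] [W.IsGloballyMinimal] (hW : W = ⟨1, 1, 1, 4165, 27465⟩) (hr : W.analyticRank = 0)
    (hunit : ∃ q : ℚ, shaAn W = (q : ℂ) ∧ padicValRat 5 q = 0) : X2.MazurMainConjectureAt W 5 := by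
  subst hW
  exact EisensteinPrimesMazurMCOnCellBOfNamedFactsV9.mazurMainConjectureAt_of_namedFacts_of_classShaUnit hP hW21 _ 5
    (EisensteinPrimesMazurMCOnCellBTwistbackUnitEndP5Cell4910g1.cellB_4910g1_of_analyticRank hr)
    ⟨_, inferInstance, inferInstance, WeierstrassCurve.isIsogenous_self _, hunit⟩

/-- **`BSD(E, 5)` at `4910g1` from PUBLISHED inputs only + the same two readings** (w3 g14's `…DefectSwapUp.bsdp_of_cellB_of_classShaUnit`:
Wuthrich Prop. 21 + GZK at the unit member, Cassels). CONDITIONAL; nothing booked.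
[cite: Wuthrich2014, Prop. 21 (p. 400)] [cite: MilneADT2006, Thm. I.7.3] [cite: Miller2011LMS, Def. 1.1] -/
theorem bsdp_4910g1_at_five_of_shaUnit (hP : EisensteinPrimes.PublishedInputs) (hW21 : sha_dvd_analyticSha)
    (W : WeierstrassCurve ℚ) [W.IsElliptic] [W.IsGloballyMinimal] (hW : W = ⟨1, 1, 1, 4165, 27465⟩) (hr : W.analyticRank = 0)
    (hunit : ∃ q : ℚ, shaAn W = (q : ℂ) ∧ padicValRat 5 q = 0) : BSDp W 5 := by
  subst hW
  exact EisensteinPrimesMazurMCOnCellBTwistbackDefectSwapUp.bsdp_of_cellB_of_classShaUnit hP hW21 _ 5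
    (EisensteinPrimesMazurMCOnCellBTwistbackUnitEndP5Cell4910g1.cellB_4910g1_of_analyticRank hr) ⟨_, inferInstance, inferInstance, WeierstrassCurve.isIsogenous_self _, hunit⟩

/-! ## `(16530ba1, 5)` — a Ш-unit vertex (`#Ш_an(16530ba1) = 1`) -/

-- 6⁷'s LEFT disjunct at `(16530ba1, 5)` at distance 0: the statement does not depend on the curve — it IS the landed
-- `…ShaUnitVertexDisplays01.connectedClassShaUnit_395c1_refl` (p698143), applied to this `W` and `hunit`; not restated (dedup).

/-- **Mazur's main conjecture at `(16530ba1, 5)` from PUBLISHED inputs only + two Cremona readings** (`hr`: `r_an = 0`, `L(E,1) = 6.32217624`;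
`hunit`: `#Ш_an = 1`, `#T = 5`, `∏c = 125`, `Ω = 1.26443525`): `X2.CellB` in the kernel (p697205's `cellB_16530ba1_of_analyticRank`), the class's
own unit member (identity isogeny), `…OfNamedFactsV9.mazurMainConjectureAt_of_namedFacts_of_classShaUnit` (Wuthrich Prop. 21 + GZK,
Cassels, `X2.mazurMainConjectureAt_of_bsdp_of_red`). Cone: `PublishedInputs`, `sha_dvd_analyticSha` — both PUBLISHED. CONDITIONAL;
nothing booked. [cite: Wuthrich2014, Prop. 21 (p. 400) and Thm. 16 (p. 397)] [cite: MilneADT2006, Thm. I.7.3] [cite: Miller2011LMS, Def. 1.1] -/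
theorem mazurMainConjectureAt_16530ba1_at_five_of_shaUnit (hP : EisensteinPrimes.PublishedInputs) (hW21 : sha_dvd_analyticSha)
    (W : WeierstrassCurve ℚ) [W.IsElliptic] [W.IsGloballyMinimal] (hW : W = ⟨1, 0, 0, -2975, 62457⟩) (hr : W.analyticRank = 0)
    (hunit : ∃ q : ℚ, shaAn W = (q : ℂ) ∧ padicValRat 5 q = 0) : X2.MazurMainConjectureAt W 5 := by
  subst hW
  exact EisensteinPrimesMazurMCOnCellBOfNamedFactsV9.mazurMainConjectureAt_of_namedFacts_of_classShaUnit hP hW21 _ 5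
    (EisensteinPrimesMazurMCOnCellBTwistbackUnitEndP5Cell16530ba1.cellB_16530ba1_of_analyticRank hr)
    ⟨_, inferInstance, inferInstance, WeierstrassCurve.isIsogenous_self _, hunit⟩

/-- **`BSD(E, 5)` at `16530ba1` from PUBLISHED inputs only + the same two readings** (w3 g14's `…DefectSwapUp.bsdp_of_cellB_of_classShaUnit`:
Wuthrich Prop. 21 + GZK at the unit member, Cassels). CONDITIONAL; nothing booked.
[cite: Wuthrich2014, Prop. 21 (p. 400)] [cite: MilneADT2006, Thm. I.7.3] [cite: Miller2011LMS, Def. 1.1] -/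
theorem bsdp_16530ba1_at_five_of_shaUnit (hP : EisensteinPrimes.PublishedInputs) (hW21 : sha_dvd_analyticSha)
    (W : WeierstrassCurve ℚ) [W.IsElliptic] [W.IsGloballyMinimal] (hW : W = ⟨1, 0, 0, -2975, 62457⟩) (hr : W.analyticRank = 0)
    (hunit : ∃ q : ℚ, shaAn W = (q : ℂ) ∧ padicValRat 5 q = 0) : BSDp W 5 := by
  subst hW
  exact EisensteinPrimesMazurMCOnCellBTwistbackDefectSwapUp.bsdp_of_cellB_of_classShaUnit hP hW21 _ 5
    (EisensteinPrimesMazurMCOnCellBTwistbackUnitEndP5Cell16530ba1.cellB_16530ba1_of_analyticRank hr) ⟨_, inferInstance, inferInstance, WeierstrassCurve.isIsogenous_self _, hunit⟩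

/-! ## `(28965i1, 5)` — a Ш-unit vertex (`#Ш_an(28965i1) = 1`) -/

-- 6⁷'s LEFT disjunct at `(28965i1, 5)` at distance 0: the statement does not depend on the curve — it IS the landed
-- `…ShaUnitVertexDisplays01.connectedClassShaUnit_395c1_refl` (p698143), applied to this `W` and `hunit`; not restated (dedup).

/-- **Mazur's main conjecture at `(28965i1, 5)` from PUBLISHED inputs only + two Cremona readings** (`hr`: `r_an = 0`, `L(E,1) = 1.46719481`;
`hunit`: `#Ш_an = 1`, `#T = 5`, `∏c = 100`, `Ω = 0.36679870`): `X2.CellB` in the kernel (p697238's `cellB_28965i1_of_analyticRank`), the class's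
own unit member (identity isogeny), `…OfNamedFactsV9.mazurMainConjectureAt_of_namedFacts_of_classShaUnit` (Wuthrich Prop. 21 + GZK,
Cassels, `X2.mazurMainConjectureAt_of_bsdp_of_red`). Cone: `PublishedInputs`, `sha_dvd_analyticSha` — both PUBLISHED. CONDITIONAL;
nothing booked. [cite: Wuthrich2014, Prop. 21 (p. 400) and Thm. 16 (p. 397)] [cite: MilneADT2006, Thm. I.7.3] [cite: Miller2011LMS, Def. 1.1] -/
theorem mazurMainConjectureAt_28965i1_at_five_of_shaUnit (hP : EisensteinPrimes.PublishedInputs) (hW21 : sha_dvd_analyticSha)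
    (W : WeierstrassCurve ℚ) [W.IsElliptic] [W.IsGloballyMinimal] (hW : W = ⟨0, 1, 1, 7560, 1587944⟩) (hr : W.analyticRank = 0)
    (hunit : ∃ q : ℚ, shaAn W = (q : ℂ) ∧ padicValRat 5 q = 0) : X2.MazurMainConjectureAt W 5 := by
  subst hW
  exact EisensteinPrimesMazurMCOnCellBOfNamedFactsV9.mazurMainConjectureAt_of_namedFacts_of_classShaUnit hP hW21 _ 5
    (EisensteinPrimesMazurMCOnCellBTwistbackUnitEndP5Cell28965i1.cellB_28965i1_of_analyticRank hr)
    ⟨_, inferInstance, inferInstance, WeierstrassCurve.isIsogenous_self _, hunit⟩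

/-- **`BSD(E, 5)` at `28965i1` from PUBLISHED inputs only + the same two readings** (w3 g14's `…DefectSwapUp.bsdp_of_cellB_of_classShaUnit`:
Wuthrich Prop. 21 + GZK at the unit member, Cassels). CONDITIONAL; nothing booked.
[cite: Wuthrich2014, Prop. 21 (p. 400)] [cite: MilneADT2006, Thm. I.7.3] [cite: Miller2011LMS, Def. 1.1] -/
theorem bsdp_28965i1_at_five_of_shaUnit (hP : EisensteinPrimes.PublishedInputs) (hW21 : sha_dvd_analyticSha)
    (W : WeierstrassCurve ℚ) [W.IsElliptic] [W.IsGloballyMinimal] (hW : W = ⟨0, 1, 1, 7560, 1587944⟩) (hr : W.analyticRank = 0)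
    (hunit : ∃ q : ℚ, shaAn W = (q : ℂ) ∧ padicValRat 5 q = 0) : BSDp W 5 := by
  subst hW
  exact EisensteinPrimesMazurMCOnCellBTwistbackDefectSwapUp.bsdp_of_cellB_of_classShaUnit hP hW21 _ 5
    (EisensteinPrimesMazurMCOnCellBTwistbackUnitEndP5Cell28965i1.cellB_28965i1_of_analyticRank hr) ⟨_, inferInstance, inferInstance, WeierstrassCurve.isIsogenous_self _, hunit⟩

/-! ## `(546f1, 7)` — a Ш-unit vertex (`#Ш_an(546f1) = 1`) -/

/-- **6⁷'s LEFT disjunct at `(546f1, 7)` AT DISTANCE 0** (the registered stub's «connected Ш-unit class» hypothesis VERBATIM):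
`W₁ = W₃ = Wc = W`, the trivial zig-zag (`Relation.ReflTransGen.refl`), the identity isogenies, ONE reading `hunit` (`#Ш_an(546f1) = 1`,
Cremona). Fact-free. [cite: CremonaAlgorithms1997, Table 1] -/
theorem connectedClassShaUnit_546f1_refl
    (W : WeierstrassCurve ℚ) [W.IsElliptic] [W.IsGloballyMinimal]
    (hunit : ∃ q : ℚ, shaAn W = (q : ℂ) ∧ padicValRat 7 q = 0) :
    ∃ (W₁ : WeierstrassCurve ℚ) (_ : W₁.IsElliptic) (_ : W₁.IsGloballyMinimal)
      (W₃ : WeierstrassCurve ℚ) (_ : W₃.IsElliptic) (_ : W₃.IsGloballyMinimal)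
      (Wc : WeierstrassCurve ℚ) (_ : Wc.IsElliptic) (_ : Wc.IsGloballyMinimal),
      IsIsogenous W W₁ ∧
      Relation.ReflTransGen (fun A B : WeierstrassCurve ℚ ↦ TwoStepAt 7 A B ∨
        (TwoStepAt 7 B A ∧ ∃ (_ : B.IsElliptic) (_ : B.IsGloballyMinimal), X2.CellB B 7)) W₁ W₃ ∧
      IsIsogenous W₃ Wc ∧
      ∃ q : ℚ, shaAn Wc = (q : ℂ) ∧ padicValRat 7 q = 0 :=
  ⟨W, inferInstance, inferInstance, W, inferInstance, inferInstance, W, inferInstance, inferInstance,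
    WeierstrassCurve.isIsogenous_self W, Relation.ReflTransGen.refl, WeierstrassCurve.isIsogenous_self W, hunit⟩

/-- **Mazur's main conjecture at `(546f1, 7)` from PUBLISHED inputs only + two Cremona readings** (`hr`: `r_an = 0`, `L(E,1) = 2.67156776`;
`hunit`: `#Ш_an = 1`, `#T = 7`, `∏c = 343`, `Ω = 0.38165254`): `X2.CellB` in the kernel (p694064's `cellB_546f1_of_analyticRank`), the class's
own unit member (identity isogeny), `…OfNamedFactsV9.mazurMainConjectureAt_of_namedFacts_of_classShaUnit` (Wuthrich Prop. 21 + GZK,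
Cassels, `X2.mazurMainConjectureAt_of_bsdp_of_red`). Cone: `PublishedInputs`, `sha_dvd_analyticSha` — both PUBLISHED. CONDITIONAL;
nothing booked. [cite: Wuthrich2014, Prop. 21 (p. 400) and Thm. 16 (p. 397)] [cite: MilneADT2006, Thm. I.7.3] [cite: Miller2011LMS, Def. 1.1] -/
theorem mazurMainConjectureAt_546f1_at_seven_of_shaUnit (hP : EisensteinPrimes.PublishedInputs) (hW21 : sha_dvd_analyticSha)
    (W : WeierstrassCurve ℚ) [W.IsElliptic] [W.IsGloballyMinimal] (hW : W = ⟨1, 0, 0, 714, -82908⟩) (hr : W.analyticRank = 0)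
    (hunit : ∃ q : ℚ, shaAn W = (q : ℂ) ∧ padicValRat 7 q = 0) : X2.MazurMainConjectureAt W 7 := by
  subst hW
  exact EisensteinPrimesMazurMCOnCellBOfNamedFactsV9.mazurMainConjectureAt_of_namedFacts_of_classShaUnit hP hW21 _ 7
    (EisensteinPrimesMazurMCOnCellBTwistbackUnitEndP7Cell546f1.cellB_546f1_of_analyticRank hr)
    ⟨_, inferInstance, inferInstance, WeierstrassCurve.isIsogenous_self _, hunit⟩

/-- **`BSD(E, 7)` at `546f1` from PUBLISHED inputs only + the same two readings** (w3 g14's `…DefectSwapUp.bsdp_of_cellB_of_classShaUnit`: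
Wuthrich Prop. 21 + GZK at the unit member, Cassels). CONDITIONAL; nothing booked.
[cite: Wuthrich2014, Prop. 21 (p. 400)] [cite: MilneADT2006, Thm. I.7.3] [cite: Miller2011LMS, Def. 1.1] -/
theorem bsdp_546f1_at_seven_of_shaUnit (hP : EisensteinPrimes.PublishedInputs) (hW21 : sha_dvd_analyticSha)
    (W : WeierstrassCurve ℚ) [W.IsElliptic] [W.IsGloballyMinimal] (hW : W = ⟨1, 0, 0, 714, -82908⟩) (hr : W.analyticRank = 0)
    (hunit : ∃ q : ℚ, shaAn W = (q : ℂ) ∧ padicValRat 7 q = 0) : BSDp W 7 := by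
  subst hW
  exact EisensteinPrimesMazurMCOnCellBTwistbackDefectSwapUp.bsdp_of_cellB_of_classShaUnit hP hW21 _ 7
    (EisensteinPrimesMazurMCOnCellBTwistbackUnitEndP7Cell546f1.cellB_546f1_of_analyticRank hr) ⟨_, inferInstance, inferInstance, WeierstrassCurve.isIsogenous_self _, hunit⟩

end Summit.BirchSwinnertonDyer.BirchSwinnertonDyer.Theorems.EisensteinPrimesMazurMCOnCellBTwistbackShaUnitVertexDisplays02
end
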